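import Literature.AlgebraicGeometry.Limits.PushoutOpenImmersion
import Mathlib.AlgebraicGeometry.Morphisms.Proper
import HarnessLib

/-!
# Stub `stub_glueLocalModification`: patching a proper local modification into the whole scheme
(crux stmt-ResolutionOfSingularities-15917, `RadicialJung.CleanModels`, line `Sketch` rev 10)

Route `ResolutionOfSingularities/RadicialJung`, crux item `CleanModels`, line `Sketch` (rev 10).
Pure scheme theory, no named facts. Given an open `U ⊆ W`, a proper `π : X' → U` and a closed
subset `Z ⊆ U` of `W` such that `π` is an isomorphism over `U ∖ Z`, the scheme
`W' = X' ⨿_R (W ∖ Z)` with `R = π⁻¹(U ∖ Z) ≅ U ∖ Z ⊆ W ∖ Z` (Mathlib's push-out of schemes along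
open immersions, a locally directed gluing; charts `pushout.inl`, `pushout.inr`,
`Literature/AlgebraicGeometry/Limits/PushoutOpenImmersion`) carries the glued morphism
`ρ : W' → W` (`pushout.desc (π ≫ U.ι) (W ∖ Z).ι`) with

* `X' → W'` (the chart `pushout.inl`) an open immersion with image `ρ⁻¹(U)` (a point of the chart
  `W ∖ Z` lying over `U` lies over `U ∖ Z`, where `π` is surjective, so it is already a point of
  the chart `X'`) and `X' → W' → W = π`;
* `ρ` an isomorphism over `W ∖ Z`: `ρ⁻¹(W ∖ Z)` is the chart `pushout.inr`, an inverse;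
* `ρ` proper: properness is Zariski-local on the target (Mathlib `IsZariskiLocalAtTarget` for
  `@IsProper`), `{U, W ∖ Z}` covers `W` because `Z ⊆ U`, and over these two opens `ρ` restricts
  to `π` (up to the isomorphism `ρ⁻¹(U) ≅ X'`) and to an isomorphism.

## Main results

* `preimage_pushoutDesc_eq_range_inl`, `preimage_pushoutDesc_eq_range_inr` — the preimage of a
  subset of the base under `pushout.desc p₁ p₂ _ : A ⨿_R B → S` is one chart as soon as the other
  chart meets it only inside the glued open `R`;
* `of_morphismRestrict_of_preimage_eq` — a property of morphisms respecting isomorphisms passes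
  from `α : U → O` to `Φ ∣_ O` when `Φ⁻¹(O) = U` and `Φ|_U` is induced by `α`;
* `exists_glueLocalModification` — the gluing, for an arbitrary open `V₀` with `U ⊔ V₀ = ⊤` in
  place of `W ∖ Z` (any universe);
* `stub_glueLocalModification` — the registered stub (universe `0`, `V₀ = W ∖ Z`).
-/

noncomputable section

set_option linter.dupNamespace false -- mandated namespace of this single-conjunct summit

open CategoryTheory CategoryTheory.Limits AlgebraicGeometry TopologicalSpace

namespace Summit.ResolutionOfSingularities.ResolutionOfSingularities.Theorems.RadicialJung.CleanModels

universe u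

/-! ## Preimages of opens of the base under a glued morphism -/

section Pushout

variable {R A B S : Scheme.{u}} (f : R ⟶ A) (g : R ⟶ B) [IsOpenImmersion f] [IsOpenImmersion g]
  (p₁ : A ⟶ S) (p₂ : B ⟶ S) (w : f ≫ p₁ = g ≫ p₂)

/-- If the chart `A` of `A ⨿_R B` meets the part over `O ⊆ S` only inside `f(R)` and `B` lies
over `O`, then the preimage of `O` under the glued morphism `A ⨿_R B → S` is the chart `B`
(every point of the push-out lies in one of the two charts, and `inl ∘ f = inr ∘ g`). -/
theorem preimage_pushoutDesc_eq_range_inr (O : Set S) (h₂ : ∀ b, p₂ b ∈ O)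
    (h₁ : ∀ a, p₁ a ∈ O → a ∈ Set.range f) :
    pushout.desc p₁ p₂ w ⁻¹' O = Set.range (pushout.inr f g) := by
  ext x
  constructor
  · intro hx
    rcases (Set.eq_univ_iff_forall.mp
      (Literature.AlgebraicGeometry.Limits.range_inl_union_range_inr f g)) x with ⟨a, rfl⟩ | ⟨b, rfl⟩
    · change (pushout.inl f g ≫ pushout.desc p₁ p₂ w) a ∈ O at hx
      rw [pushout.inl_desc] at hx
      obtain ⟨r, rfl⟩ := h₁ a hx
      refine ⟨g r, ?_⟩
      change (g ≫ pushout.inr f g) r = (f ≫ pushout.inl f g) r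
      rw [pushout.condition]
    · exact ⟨b, rfl⟩
  · rintro ⟨b, rfl⟩
    change (pushout.inr f g ≫ pushout.desc p₁ p₂ w) b ∈ O
    rw [pushout.inr_desc]
    exact h₂ b

/-- Symmetrically: if the chart `B` meets the part over `O ⊆ S` only inside `g(R)` and `A` lies
over `O`, then the preimage of `O` under `A ⨿_R B → S` is the chart `A`. -/
theorem preimage_pushoutDesc_eq_range_inl (O : Set S) (h₁ : ∀ a, p₁ a ∈ O)
    (h₂ : ∀ b, p₂ b ∈ O → b ∈ Set.range g) :
    pushout.desc p₁ p₂ w ⁻¹' O = Set.range (pushout.inl f g) := by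
  ext x
  constructor
  · intro hx
    rcases (Set.eq_univ_iff_forall.mp
      (Literature.AlgebraicGeometry.Limits.range_inl_union_range_inr f g)) x with ⟨a, rfl⟩ | ⟨b, rfl⟩
    · exact ⟨a, rfl⟩
    · change (pushout.inr f g ≫ pushout.desc p₁ p₂ w) b ∈ O at hx
      rw [pushout.inr_desc] at hx
      obtain ⟨r, rfl⟩ := h₂ b hx
      refine ⟨f r, ?_⟩
      change (f ≫ pushout.inl f g) r = (g ≫ pushout.inr f g) r
      rw [pushout.condition]
  · rintro ⟨a, rfl⟩
    change (pushout.inl f g ≫ pushout.desc p₁ p₂ w) a ∈ O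
    rw [pushout.inl_desc]
    exact h₁ a

end Pushout

/-! ## Restricting over an open whose preimage is known -/

/-- If `Φ⁻¹(O) = U` and `Φ|_U : U → O` is induced by `α`, then `Φ ∣_ O` is `α` up to the
isomorphism `Φ⁻¹(O) ≅ U`; so every property of morphisms which respects isomorphisms passes from
`α` to `Φ ∣_ O`. -/
theorem of_morphismRestrict_of_preimage_eq (P : MorphismProperty Scheme.{u}) [P.RespectsIso]
    {Y T : Scheme.{u}} (Φ : Y ⟶ T) (U : Y.Opens) (O : T.Opens) (α : (U : Scheme.{u}) ⟶ O)
    (hα : U.ι ≫ Φ = α ≫ O.ι) (hU : Φ ⁻¹ᵁ O = U) (h : P α) : P (Φ ∣_ O) := by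
  have e : Φ ∣_ O = (Y.isoOfEq hU).hom ≫ α := by
    rw [← cancel_mono O.ι, morphismRestrict_ι, Category.assoc, ← hα, ← Category.assoc,
      Scheme.isoOfEq_hom_ι]
  rw [e, P.cancel_left_of_respectsIso]
  exact h

/-! ## The gluing -/

section Glue

variable {W X' : Scheme.{u}} (U V₀ : W.Opens) (π : X' ⟶ (U : Scheme.{u}))

/-- **Patching a proper local modification over an open into the whole scheme.** For opens
`U, V₀` covering `W` and a proper `π : X' → U` which is an isomorphism over `U ∩ V₀`, glue `X'`
and `V₀` along `R = π⁻¹(U ∩ V₀) ≅ U ∩ V₀` (push-out of schemes along the open immersions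
`R ⊆ X'` and `R ≅ U ∩ V₀ ⊆ V₀`): the glued `ρ : X' ⨿_R V₀ → W` is proper, the chart `X'` is an
open immersion onto `ρ⁻¹(U)` over which `ρ` is `π`, and `ρ` is an isomorphism over `V₀`. -/
theorem exists_glueLocalModification [IsProper π] (hcov : U ⊔ V₀ = ⊤)
    [IsIso (π ∣_ (U.ι ⁻¹ᵁ V₀))] :
    ∃ (W' : Scheme.{u}) (ρ : W' ⟶ W) (e : X' ⟶ W'), IsProper ρ ∧ IsOpenImmersion e ∧
      e ≫ ρ = π ≫ U.ι ∧ Set.range e.base = ρ.base ⁻¹' (U : Set W) ∧ IsIso (ρ ∣_ V₀) := by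
  -- the two open immersions along which we glue: `R = π⁻¹(U ∩ V₀) ⊆ X'` and
  -- `R ≅ U ∩ V₀ ⊆ V₀`
  let m₁ : ((π ⁻¹ᵁ (U.ι ⁻¹ᵁ V₀) : X'.Opens) : Scheme.{u}) ⟶ X' := (π ⁻¹ᵁ (U.ι ⁻¹ᵁ V₀)).ι
  let m₂ : ((π ⁻¹ᵁ (U.ι ⁻¹ᵁ V₀) : X'.Opens) : Scheme.{u}) ⟶ V₀ :=
    (π ∣_ (U.ι ⁻¹ᵁ V₀)) ≫ (U.ι ∣_ V₀)
  haveI hm₁ : IsOpenImmersion m₁ := inferInstanceAs (IsOpenImmersion (π ⁻¹ᵁ (U.ι ⁻¹ᵁ V₀)).ι)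
  haveI hm₂ : IsOpenImmersion m₂ :=
    inferInstanceAs (IsOpenImmersion ((π ∣_ (U.ι ⁻¹ᵁ V₀)) ≫ (U.ι ∣_ V₀)))
  have w : m₁ ≫ π ≫ U.ι = m₂ ≫ V₀.ι := by
    simp only [m₁, m₂, Category.assoc, morphismRestrict_ι, morphismRestrict_ι_assoc]
  haveI := Literature.AlgebraicGeometry.Limits.isOpenImmersion_inl m₁ m₂
  haveI := Literature.AlgebraicGeometry.Limits.isOpenImmersion_inr m₁ m₂
  -- the chart `X'` meets the part over `V₀` only in `R`
  have h₁ : ∀ a : X', (π ≫ U.ι) a ∈ (V₀ : Set W) → a ∈ Set.range m₁ := by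
    intro a ha
    exact ⟨⟨a, ha⟩, rfl⟩
  -- the chart `V₀` meets the part over `U` only in `R` (here the surjectivity of `π|_R` enters)
  have h₂ : ∀ b : V₀, V₀.ι b ∈ (U : Set W) → b ∈ Set.range m₂ := by
    intro b hb
    have hbV : (⟨V₀.ι b, hb⟩ : U) ∈ U.ι ⁻¹ᵁ V₀ := b.2
    obtain ⟨r, hr⟩ := (π ∣_ (U.ι ⁻¹ᵁ V₀)).surjective ⟨⟨V₀.ι b, hb⟩, hbV⟩
    refine ⟨r, Subtype.ext ?_⟩
    change ((U.ι ∣_ V₀) ((π ∣_ (U.ι ⁻¹ᵁ V₀)) r)).1 = (b : W)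
    rw [morphismRestrict_base_coe, hr]
    rfl
  -- preimages of `U` and of `V₀` under the glued morphism
  have hU : pushout.desc (π ≫ U.ι) V₀.ι w ⁻¹' (U : Set W) = Set.range (pushout.inl m₁ m₂) :=
    preimage_pushoutDesc_eq_range_inl m₁ m₂ (π ≫ U.ι) V₀.ι w U (fun a => (π a).2) h₂
  have hV₀ : pushout.desc (π ≫ U.ι) V₀.ι w ⁻¹' (V₀ : Set W) = Set.range (pushout.inr m₁ m₂) :=
    preimage_pushoutDesc_eq_range_inr m₁ m₂ (π ≫ U.ι) V₀.ι w V₀ (fun b => b.2) h₁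
  -- over `V₀` the glued morphism is an isomorphism: the chart `inr` is an inverse
  haveI hiso : IsIso (pushout.desc (π ≫ U.ι) V₀.ι w ∣_ V₀) :=
    Literature.AlgebraicGeometry.Limits.isIso_morphismRestrict_of_preimage_eq _
      (pushout.inr m₁ m₂).opensRange V₀ (pushout.inr m₁ m₂).isoOpensRange.inv
      (by rw [← Scheme.Hom.isoOpensRange_inv_comp (pushout.inr m₁ m₂), Category.assoc,
        pushout.inr_desc])
      (Opens.ext hV₀)
  -- properness is local on the target; over `U` the glued morphism is `π` up to isomorphism
  have hproper : IsProper (pushout.desc (π ≫ U.ι) V₀.ι w) := by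
    refine IsZariskiLocalAtTarget.of_iSup_eq_top (P := @IsProper) (fun b : Bool => cond b U V₀)
      (by rw [iSup_bool_eq]; exact hcov) ?_
    rintro (_ | _)
    · change IsProper (pushout.desc (π ≫ U.ι) V₀.ι w ∣_ V₀)
      exact MorphismProperty.of_isIso @IsProper _
    · change IsProper (pushout.desc (π ≫ U.ι) V₀.ι w ∣_ U)
      refine of_morphismRestrict_of_preimage_eq @IsProper _ (pushout.inl m₁ m₂).opensRange U
        ((pushout.inl m₁ m₂).isoOpensRange.inv ≫ π) ?_ (Opens.ext hU) inferInstance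
      rw [Category.assoc, ← Scheme.Hom.isoOpensRange_inv_comp (pushout.inl m₁ m₂),
        Category.assoc, pushout.inl_desc]
  exact ⟨pushout m₁ m₂, pushout.desc (π ≫ U.ι) V₀.ι w, pushout.inl m₁ m₂, hproper, inferInstance,
    pushout.inl_desc _ _ _, hU.symm, hiso⟩

end Glue

/-! ## The registered stub -/

/-- STUB `stub_glueLocalModification` of line `Sketch` (rev 10) — **a proper modification of an
open `U ⊆ W` which is an isomorphism off a closed `Z ⊆ U` glues with `W ∖ Z` to a proper
modification of `W`**: there are `ρ : W' → W` proper and an open immersion `e : X' → W'` onto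
`ρ⁻¹(U)` with `e ≫ ρ = π ≫ U.ι` and `ρ` an isomorphism over `W ∖ Z`
(`exists_glueLocalModification` with `V₀ = W ∖ Z`; `U ∪ (W ∖ Z) = W` because `Z ⊆ U`). -/
theorem stub_glueLocalModification {W X' : Scheme.{0}} (U : W.Opens)
    (π : X' ⟶ (U : Scheme.{0})) [IsProper π] (Z : Set W) (hZ : IsClosed Z)
    (hZU : Z ⊆ (U : Set W))
    [IsIso (π ∣_ (U.ι ⁻¹ᵁ ⟨Zᶜ, hZ.isOpen_compl⟩))] :
    ∃ (W' : Scheme.{0}) (ρ : W' ⟶ W) (e : X' ⟶ W'), IsProper ρ ∧ IsOpenImmersion e ∧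
      e ≫ ρ = π ≫ U.ι ∧ Set.range e.base = ρ.base ⁻¹' (U : Set W) ∧
      IsIso (ρ ∣_ ⟨Zᶜ, hZ.isOpen_compl⟩) := by
  refine exists_glueLocalModification U ⟨Zᶜ, hZ.isOpen_compl⟩ π ?_
  refine top_unique fun x _ => ?_
  by_cases hx : x ∈ Z
  · exact Or.inl (hZU hx)
  · exact Or.inr hx

end Summit.ResolutionOfSingularities.ResolutionOfSingularities.Theorems.RadicialJung.CleanModels

end
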